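import Literature.NumberTheory.LFunctions.HalaszEulerProduct
import Literature.NumberTheory.LFunctions.TaoLogElliottCMization
import HarnessLib

/-!
# Granville–Soundararajan 2003, §3b: `F' = F · (G'/G) + G · H'` for multiplicative `f`

Fifth file of the proof of Theorem 1 of Granville–Soundararajan (sharp Halász).  For a
multiplicative `1`-bounded `f`, the paper factors the Euler product `F = G · H` with `G` the
Euler product of the completely multiplicative function `g` with the same prime values and `H`
absolutely convergent (with `|H|, |H'| ≪ 1`) on `Re s ≥ 1`, and uses `F' = F (G'/G) + G H'`
(display (3.12)).  We realise this at the level of coefficients, with the `(N+1)`-smooth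
truncations of the tree (`Halasz.smoothCut`, `mulLog`, `mulVM`) and the decomposition
`f = g̃ * h` of `TaoLogElliottCMization.lean` (`g̃ = cmLift f`, `h = cmDefect f`):
`f̃ log = (g̃Λ)~ ⋆ f̃ + g̃~ ⋆ (h̃ log)` (Dirichlet convolution of sequences), whence on `Re s > 1`
`D_f(s) = P_g(s) F(s) + G(s) E_h(s)` with `E_h(s) = ∑ h̃(n) log n · n^{-s}`, `|E_h(s)| ≤ 3 C_h`
(`C_h = cmDefectBound`, from `∑_d |h(d)| d^{-2/3} ≤ C_h`).

## Main results
- `convolution_assoc`, `convolution_mul_log` (Leibniz rule for `· log` over `⋆`),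
  `smoothCut_convolution` (`(a ⋆ b)~ = ã ⋆ b̃`).
- `mulLog_eq_convolution_add` : the coefficient identity.
- `norm_LSeries_mulLog_cmDefect_le` : `|E_h(s)| ≤ 3 cmDefectBound` on `Re s ≥ 1` (and summability).
- `LSeries_mulLog_eq_add` : `D_f = P_g F + G E_h` on `Re s > 1`.

## References
- [GranvilleSoundararajan2003] A. Granville, K. Soundararajan, *Decay of mean values of
  multiplicative functions*, Canad. J. Math. 55 (2003), §3b, (3.12), arXiv math/9911246 p. 7.
-/

noncomputable section

open Finset Real Complex
open scoped LSeries.notation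

namespace Literature.NumberTheory.LFunctions

namespace GranvilleSoundararajan

open Halasz (smoothCut mulLog mulVM smoothCut_of_mem smoothCut_of_not_mem norm_smoothCut_le
  smoothCut_zero)

/-! ### Algebra of Dirichlet convolution of sequences -/

/-- Dirichlet convolution of sequences is associative. [folklore] -/
theorem convolution_assoc {R : Type*} [Semiring R] (a b c : ℕ → R) : (a ⍟ b) ⍟ c = a ⍟ (b ⍟ c) := by
  simp only [LSeries.convolution, ArithmeticFunction.toArithmeticFunction_eq_self, mul_assoc]

/-- Pointwise form of `LSeries.convolution`. [folklore] -/
theorem convolution_apply (a b : ℕ → ℂ) (n : ℕ) :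
    (a ⍟ b) n = ∑ p ∈ n.divisorsAntidiagonal, a p.1 * b p.2 := by
  rw [LSeries.convolution_def]

/-- **Leibniz rule**: `(a ⋆ b) · log = (a · log) ⋆ b + a ⋆ (b · log)` (`log` is additive).
[folklore] -/
theorem convolution_mul_log (a b : ℕ → ℂ) :
    (fun n => (a ⍟ b) n * (Real.log n : ℂ)) =
      (fun n => a n * (Real.log n : ℂ)) ⍟ b + a ⍟ (fun n => b n * (Real.log n : ℂ)) := by
  funext n
  rw [Pi.add_apply, convolution_apply, convolution_apply, convolution_apply, Finset.sum_mul,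
    ← Finset.sum_add_distrib]
  refine Finset.sum_congr rfl fun p hp => ?_
  have hkm := (Nat.mem_divisorsAntidiagonal.mp hp).1
  obtain ⟨hk, hm⟩ := Nat.ne_zero_of_mem_divisorsAntidiagonal hp
  have hlog : (Real.log n : ℂ) = Real.log p.1 + Real.log p.2 := by
    rw [← hkm, Nat.cast_mul, Real.log_mul (by exact_mod_cast hk) (by exact_mod_cast hm)]
    push_cast; ring
  rw [hlog]; ring

/-- **Smooth truncation commutes with convolution**: `(a ⋆ b)~ = ã ⋆ b̃` (divisors of smooth numbers
are smooth; a product of smooth numbers is smooth). [folklore] -/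
theorem smoothCut_convolution (a b : ℕ → ℂ) (N : ℕ) :
    smoothCut (a ⍟ b) N = smoothCut a N ⍟ smoothCut b N := by
  funext n
  rw [convolution_apply]
  by_cases hn : n ∈ Nat.smoothNumbers (N + 1)
  · rw [smoothCut_of_mem hn, convolution_apply]
    refine Finset.sum_congr rfl fun p hp => ?_
    have hkm := (Nat.mem_divisorsAntidiagonal.mp hp).1
    have hk : p.1 ∈ Nat.smoothNumbers (N + 1) := Nat.mem_smoothNumbers_of_dvd hn (Dvd.intro _ hkm)
    have hm : p.2 ∈ Nat.smoothNumbers (N + 1) := Nat.mem_smoothNumbers_of_dvd hn (Dvd.intro_left _ hkm)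
    rw [smoothCut_of_mem hk, smoothCut_of_mem hm]
  · rw [smoothCut_of_not_mem hn]
    refine (Finset.sum_eq_zero fun p hp => ?_).symm
    have hkm := (Nat.mem_divisorsAntidiagonal.mp hp).1
    by_cases hk : p.1 ∈ Nat.smoothNumbers (N + 1)
    · have hm : p.2 ∉ Nat.smoothNumbers (N + 1) := fun hm => hn (hkm ▸ Nat.mul_mem_smoothNumbers hk hm)
      rw [smoothCut_of_not_mem hm, mul_zero]
    · rw [smoothCut_of_not_mem hk, zero_mul]

/-! ### The coefficient identity `f̃ log = (g̃Λ)~ ⋆ f̃ + g̃~ ⋆ (h̃ log)` -/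

/-- **The coefficient identity**: for any arithmetic function `f`, with `g = cmLift f` (completely
multiplicative, `f = g * cmDefect f`) and `h = cmDefect f`,
`mulLog f N = mulVM g N ⋆ smoothCut f N + smoothCut g N ⋆ mulLog h N`.
[cite: GranvilleSoundararajan2003, §3b, (3.12) ("Using `F' = G'H + GH' = F(G'/G) + O(G)`")] -/
theorem mulLog_eq_convolution_add (f : ArithmeticFunction ℂ) (N : ℕ) :
    mulLog (⇑f) N = mulVM (⇑(cmLift f)) N ⍟ smoothCut (⇑f) N +
      smoothCut (⇑(cmLift f)) N ⍟ mulLog (⇑(cmDefect f)) N := by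
  set g : ArithmeticFunction ℂ := cmLift f with hg
  set h : ArithmeticFunction ℂ := cmDefect f with hh
  have hfgh : (⇑f : ℕ → ℂ) = ⇑g ⍟ ⇑h := by
    rw [ArithmeticFunction.coe_mul, hg, hh, cmLift_mul_cmDefect]
  have hcut : smoothCut (⇑f) N = smoothCut (⇑g) N ⍟ smoothCut (⇑h) N := by
    rw [hfgh, smoothCut_convolution]
  have hgcm : ∀ m n : ℕ, g (m * n) = g m * g n := cmLift_mul f
  have hDg : mulLog (⇑g) N = mulVM (⇑g) N ⍟ smoothCut (⇑g) N :=
    (Halasz.convolution_mulVM_smoothCut (N := N) hgcm).symm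
  have hL : mulLog (⇑f) N = fun n => (smoothCut (⇑g) N ⍟ smoothCut (⇑h) N) n * (Real.log n : ℂ) := by
    funext n; unfold mulLog; rw [hcut]
  rw [hL, convolution_mul_log]
  change mulLog (⇑g) N ⍟ smoothCut (⇑h) N + smoothCut (⇑g) N ⍟ mulLog (⇑h) N = _
  rw [hDg, convolution_assoc, ← hcut]

/-! ### Summability and the bound for `E_h` -/

/-- `log n ≤ 3 n^{1/3}`. [folklore] -/
theorem log_le_three_mul_rpow_third (n : ℕ) : Real.log n ≤ 3 * (n : ℝ) ^ (1 / 3 : ℝ) := by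
  have := Real.log_le_rpow_div (Nat.cast_nonneg n) (by norm_num : (0 : ℝ) < 1 / 3)
  linarith

/-- Termwise: `‖h̃(n) log n / n^s‖ ≤ 3 |h(n)| n^{-2/3}` for `Re s ≥ 1`. [folklore] -/
theorem norm_term_mulLog_le_defectWeight (f : ArithmeticFunction ℂ) (N : ℕ) {s : ℂ} (hs : 1 ≤ s.re)
    (n : ℕ) : ‖LSeries.term (mulLog (⇑(cmDefect f)) N) s n‖ ≤ 3 * defectWeight f n := by
  rcases Nat.eq_zero_or_pos n with rfl | hn
  · simp [defectWeight_nonneg]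
  have hn0 : (0 : ℝ) < n := by exact_mod_cast hn
  have hn1 : (1 : ℝ) ≤ n := by exact_mod_cast hn
  rw [LSeries.term_of_ne_zero hn.ne', norm_div, Complex.norm_natCast_cpow_of_pos hn]
  unfold mulLog defectWeight
  rw [norm_mul, Complex.norm_real, Real.norm_of_nonneg (Real.log_nonneg hn1)]
  have h1 : ‖smoothCut (⇑(cmDefect f)) N n‖ ≤ ‖cmDefect f n‖ := Halasz.norm_smoothCut_le_norm n
  have h2 : (n : ℝ) ≤ (n : ℝ) ^ s.re := by
    calc (n : ℝ) = (n : ℝ) ^ (1 : ℝ) := (Real.rpow_one _).symm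
      _ ≤ (n : ℝ) ^ s.re := Real.rpow_le_rpow_of_exponent_le hn1 hs
  have h3 := log_le_three_mul_rpow_third n
  have hpow : (n : ℝ) ^ (1 / 3 : ℝ) / n = (n : ℝ) ^ (-(2 / 3 : ℝ)) := by
    rw [div_eq_mul_inv, ← Real.rpow_neg_one, ← Real.rpow_add hn0]; norm_num
  calc ‖smoothCut (⇑(cmDefect f)) N n‖ * Real.log n / (n : ℝ) ^ s.re
      ≤ ‖cmDefect f n‖ * (3 * (n : ℝ) ^ (1 / 3 : ℝ)) / n := by
        gcongr
    _ = 3 * (‖cmDefect f n‖ * ((n : ℝ) ^ (1 / 3 : ℝ) / n)) := by ring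
    _ = 3 * (‖cmDefect f n‖ * (n : ℝ) ^ (-(2 / 3 : ℝ))) := by rw [hpow]

/-- **Summability of `E_h` and `|E_h(s)| ≤ 3 cmDefectBound`** on `Re s ≥ 1`, for multiplicative
`1`-bounded `f` (`∑_d |h(d)| d^{-2/3} ≤ cmDefectBound`, `TaoLogElliottCMization`).
[cite: GranvilleSoundararajan2003, §3b ("`|H(s)|, |H'(s)| ≪ 1`")] -/
theorem norm_LSeries_mulLog_cmDefect_le (f : ArithmeticFunction ℂ) (hf : f.IsMultiplicative)
    (hfb : ∀ n, ‖f n‖ ≤ 1) (N : ℕ) {s : ℂ} (hs : 1 ≤ s.re) :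
    LSeriesSummable (mulLog (⇑(cmDefect f)) N) s ∧
      ‖LSeries (mulLog (⇑(cmDefect f)) N) s‖ ≤ 3 * cmDefectBound := by
  have hterm := norm_term_mulLog_le_defectWeight f N hs
  have hpart : ∀ m : ℕ, ∑ i ∈ Finset.range m, ‖LSeries.term (mulLog (⇑(cmDefect f)) N) s i‖ ≤
      3 * cmDefectBound := by
    intro m
    calc ∑ i ∈ Finset.range m, ‖LSeries.term (mulLog (⇑(cmDefect f)) N) s i‖
        ≤ ∑ i ∈ Finset.range m, 3 * defectWeight f i := Finset.sum_le_sum fun i _ => hterm i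
      _ ≤ ∑ i ∈ Icc 0 m, 3 * defectWeight f i :=
          Finset.sum_le_sum_of_subset_of_nonneg (fun i hi => by
            rw [Finset.mem_range] at hi; rw [Finset.mem_Icc]; omega)
            (fun i _ _ => mul_nonneg (by norm_num) (defectWeight_nonneg f i))
      _ = 3 * defectWeight f 0 + ∑ i ∈ Icc 1 m, 3 * defectWeight f i := by
          rw [Finset.Icc_eq_cons_Ioc (Nat.zero_le m), Finset.sum_cons]; rfl
      _ = 3 * ∑ i ∈ Icc 1 m, defectWeight f i := by
          rw [Finset.mul_sum]; simp [defectWeight]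
      _ ≤ 3 * cmDefectBound := by gcongr; exact sum_defectWeight_le f hf hfb m
  have hsum : Summable fun n => ‖LSeries.term (mulLog (⇑(cmDefect f)) N) s n‖ :=
    summable_of_sum_range_le (fun n => norm_nonneg _) hpart
  refine ⟨hsum.of_norm, ?_⟩
  calc ‖LSeries (mulLog (⇑(cmDefect f)) N) s‖ ≤ ∑' n, ‖LSeries.term (mulLog (⇑(cmDefect f)) N) s n‖ :=
        norm_tsum_le_tsum_norm hsum
    _ ≤ 3 * cmDefectBound := Real.tsum_le_of_sum_range_le (fun n => norm_nonneg _) hpart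

/-- `L`-series of a `1`-bounded sequence converge absolutely for `Re s > 1`. [folklore] -/
theorem LSeriesSummable_of_norm_le_one {a : ℕ → ℂ} (ha : ∀ n, ‖a n‖ ≤ 1) {s : ℂ} (hs : 1 < s.re) :
    LSeriesSummable a s := by
  refine LSeriesSummable_of_le_const_mul_rpow (x := 1) hs ⟨1, fun n _ => ?_⟩
  simpa using ha n

/-- **`D_f = P_g · F + G · E_h` on `Re s > 1`** (GS03 (3.12): `F' = F (G'/G) + G H'`):
for any `1`-bounded multiplicative `f`, with `g = cmLift f`, `h = cmDefect f` and the
`(N+1)`-smooth truncations,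
`∑ f̃(n) log n n^{-s} = (∑ g̃(n)Λ(n) n^{-s})(∑ f̃(n) n^{-s}) + (∑ g̃(n) n^{-s})(∑ h̃(n) log n n^{-s})`.
[cite: GranvilleSoundararajan2003, §3b, (3.12)] -/
theorem LSeries_mulLog_eq_add (f : ArithmeticFunction ℂ) (hf : f.IsMultiplicative)
    (hfb : ∀ n, ‖f n‖ ≤ 1) (N : ℕ) {s : ℂ} (hs : 1 < s.re) :
    LSeries (mulLog (⇑f) N) s =
      LSeries (mulVM (⇑(cmLift f)) N) s * LSeries (smoothCut (⇑f) N) s +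
        LSeries (smoothCut (⇑(cmLift f)) N) s * LSeries (mulLog (⇑(cmDefect f)) N) s := by
  have hgb : ∀ n, ‖cmLift f n‖ ≤ 1 := norm_cmLift_le_one f (fun p _ => hfb p)
  have h1 : LSeriesSummable (mulVM (⇑(cmLift f)) N) s := Halasz.LSeriesSummable_mulVM hgb hs
  have h2 : LSeriesSummable (smoothCut (⇑f) N) s :=
    LSeriesSummable_of_norm_le_one (fun n => norm_smoothCut_le hfb n) hs
  have h3 : LSeriesSummable (smoothCut (⇑(cmLift f)) N) s :=
    LSeriesSummable_of_norm_le_one (fun n => norm_smoothCut_le hgb n) hs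
  have h4 : LSeriesSummable (mulLog (⇑(cmDefect f)) N) s :=
    (norm_LSeries_mulLog_cmDefect_le f hf hfb N hs.le).1
  rw [mulLog_eq_convolution_add f N, LSeries_add (h1.convolution h2) (h3.convolution h4),
    LSeries_convolution' h1 h2, LSeries_convolution' h3 h4]

end GranvilleSoundararajan

end Literature.NumberTheory.LFunctions
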